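import Literature.Computability.AlgebraicComplexity.SubstitutionBacktracking
import Literature.Computability.AlgebraicComplexity.ConstrainedMatMulSandwich
import Summits.MatrixMultiplication.OmegaCensus.SmallFormats.GF2IndependenceCheck
import HarnessLib

/-!
# ω-census family (a), GF(2) rank floors: the three flattening checks for constrained `⟨l,m,n⟩` over `𝔽₂`

Cell `pub-omega` (unit `pub-omega-lit`, gen 4), topic `Summits/MatrixMultiplication/OmegaCensus` (sub-folder
`SmallFormats`). Framing (verbatim): lottery ticket; floor = certified bounds/negative ranges. HONEST FRAMING:
replay infrastructure (design note `pub-omega-lit/KERNEL-GF2-FLOORS-DESIGN.md` §7, layer R1); nothing here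
is progress on `ω`. PROVED, no facts.

For a list `K` of constraint forms (bit patterns on `l × m` matrices) let `S_K = constrSub (K.map form)`
(Wang 2026, §3.2) and `ψ_K = ⟨l,m,n⟩|_{S_K × 𝔽₂^{m×n}}`. The entries of the constrained tensor are the bits
`tbit`: `(x · E_{jk})_{i k'} = [k' = k] x_{ij}`. The three checks `flat0Check` / `flat1Check` / `flat2Check`
select rows of the three flattenings (rows = elements of `S_K` / input coordinates `(j,k)` / output
coordinates `(i,k')`, columns = the other two, the `S_K`-coordinate running over a supplied list of elements
of `S_K`) and test their independence with `indepB`; soundness (`le_of_flat0Check` etc.): every bilinear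
computation of `ψ_K` has at least that many products (Wang 2026, §6 "Flatten", via
`BilinComp.finrank_range_le_card` and the test-matrix bound).
-/

namespace Summit.MatrixMultiplication.OmegaCensus.GF2RankLB

open Module Matrix Literature.Computability.AlgebraicComplexity

/-! ## Constraint subspaces and the constrained tensor in bits -/

/-- The constraint subspace cut out by the forms with bit patterns `K`. -/
abbrev subOf (l m : ℕ) (K : List ℕ) : Submodule (ZMod 2) (Matrix (Fin l) (Fin m) (ZMod 2)) :=
  constrSub (K.map (form l m))

/-- Executable membership in `subOf l m K`. -/
def memB (N : ℕ) (K : List ℕ) (x : ℕ) : Bool := K.all fun κ => !bdot N κ x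

/-- `memB` decides membership of encoded matrices. -/
theorem ofBits_mem_subOf_iff (l m : ℕ) (K : List ℕ) (x : ℕ) :
    ofBits l m x ∈ subOf l m K ↔ memB (l * m) K x = true := by
  simp only [subOf, mem_constrSub, List.mem_map, forall_exists_index, and_imp,
    forall_apply_eq_imp_iff₂, form_ofBits_eq_zero_iff, memB, List.all_eq_true, Bool.not_eq_true']

/-- The constrained matrix multiplication map `ψ_K = ⟨l,m,n⟩|_{S_K × 𝔽₂^{m×n}}`. -/
abbrev psiK (l m n : ℕ) (K : List ℕ) :=
  (mulBilin (ZMod 2) l m n).comp (subOf l m K).subtype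

/-- The element of `S_K` encoded by `x` (given the membership check). -/
def elemOf (l m : ℕ) (K : List ℕ) (x : ℕ) (h : memB (l * m) K x = true) : subOf l m K :=
  ⟨ofBits l m x, (ofBits_mem_subOf_iff l m K x).2 h⟩

/-- Bits of the constrained tensor: the entry `(i,k')` (code `c = k' + n i`) of `x · E_{jk}`
(code `b = k + n j`) is `[k' = k] x_{ij}`. -/
def tbit (m n : ℕ) (x b c : ℕ) : Bool := (c % n == b % n) && x.testBit (pos m (c / n) (b / n))

/-- The input basis matrix with code `b`. -/
def vB (m n : ℕ) (b : Fin (m * n)) : Matrix (Fin m) (Fin n) (ZMod 2) := Matrix.single b.divNat b.modNat 1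

/-- The output coordinate functional with code `c`. -/
def eC (l n : ℕ) (c : Fin (l * n)) : Module.Dual (ZMod 2) (Matrix (Fin l) (Fin n) (ZMod 2)) :=
  Matrix.entryLinearMap (ZMod 2) (ZMod 2) c.divNat c.modNat

/-- The entries of the constrained tensor are the bits `tbit`. -/
theorem eC_mul_vB (l m n x : ℕ) (b : Fin (m * n)) (c : Fin (l * n)) :
    eC l n c (ofBits l m x * vB m n b) = if tbit m n x b c then 1 else 0 := by
  simp only [eC, vB, Matrix.entryLinearMap_apply]
  by_cases h : c.modNat = b.modNat
  · have e1 : (ofBits l m x * Matrix.single b.divNat b.modNat (1 : ZMod 2)) c.divNat c.modNat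
        = ofBits l m x c.divNat b.divNat := by
      rw [h, Matrix.mul_single_apply_same, mul_one]
    have h' : ((c : ℕ) % n == (b : ℕ) % n) = true := by
      have := congrArg Fin.val h
      simp only [Fin.coe_modNat] at this
      simp [this]
    rw [e1, ofBits_apply]
    simp [tbit, h', Fin.coe_divNat]
  · have e1 : (ofBits l m x * Matrix.single b.divNat b.modNat (1 : ZMod 2)) c.divNat c.modNat = 0 :=
      Matrix.mul_single_apply_of_ne (1 : ZMod 2) b.divNat b.modNat c.divNat c.modNat h (ofBits l m x)
    have h' : ((c : ℕ) % n == (b : ℕ) % n) = false := by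
      rw [beq_eq_false_iff_ne]
      intro hh
      exact h (Fin.ext (by rw [Fin.coe_modNat, Fin.coe_modNat]; exact hh))
    rw [e1]
    simp [tbit, h']

/-! ## Orientation 0: rows = elements of `S_K`, columns `(b, c)` -/

/-- Row of the first flattening for the element `x`: columns `(b, c)` with code `c + (l n) b`. -/
def flatRow0 (l m n : ℕ) (x : ℕ) : ℕ :=
  maskOf (fun t => tbit m n x (t / (l * n)) (t % (l * n))) ((m * n) * (l * n))

/-- The first flattening check: the listed elements lie in `S_K` and their rows are independent. -/
def flat0Check (l m n : ℕ) (K xs : List ℕ) : Bool :=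
  xs.all (memB (l * m) K) && indepB (xs.map (flatRow0 l m n))

/-- `List.ofFn` over `getD` is `map`. -/
theorem ofFn_getD_map {β : Type*} (xs : List ℕ) (f : ℕ → β) :
    (List.ofFn fun i : Fin xs.length => f (xs.getD i 0)) = xs.map f := by
  apply List.ext_getElem (by simp)
  intro i h1 h2
  simp

/-- Soundness of the first flattening check: `|xs| ≤ dim range ψ_K`. -/
theorem le_finrank_of_flat0Check {l m n : ℕ} {K xs : List ℕ} (h : flat0Check l m n K xs = true) :
    xs.length ≤ finrank (ZMod 2) (LinearMap.range (psiK l m n K)) := by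
  simp only [flat0Check, Bool.and_eq_true, List.all_eq_true] at h
  obtain ⟨hmem, hind⟩ := h
  have hmem' : ∀ i : Fin xs.length, memB (l * m) K (xs.getD i 0) = true := fun i => by
    rw [List.getD_eq_getElem _ _ i.2]; exact hmem _ (List.getElem_mem i.2)
  let E := (finProdFinEquiv : Fin (m * n) × Fin (l * n) ≃ Fin ((m * n) * (l * n)))
  refine le_finrank_range_of_indepB (psiK l m n K)
    (fun i => elemOf l m K (xs.getD i 0) (hmem' i))
    (fun t => vB m n (E.symm t).1) (fun t => eC l n (E.symm t).2)
    (fun i t => tbit m n (xs.getD i 0) (t / (l * n)) (t % (l * n))) ?_ ?_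
  · intro i t
    simp only [LinearMap.comp_apply, Submodule.subtype_apply, elemOf, mulBilin_apply, E,
      finProdFinEquiv_symm_apply, eC_mul_vB, Fin.coe_divNat, Fin.coe_modNat]
    rfl
  · change indepB (List.ofFn fun i : Fin xs.length => flatRow0 l m n (xs.getD i 0)) = true
    rw [ofFn_getD_map]
    exact hind

/-- **Flattening bound, orientation 0**: every computation of `ψ_K` has at least `|xs|` products. -/
theorem le_of_flat0Check {l m n : ℕ} {K xs : List ℕ} (h : flat0Check l m n K xs = true) (r : ℕ)
    (β : BilinComp (psiK l m n K) (Fin r)) : xs.length ≤ r :=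
  le_of_finrank_range_le (le_finrank_of_flat0Check h) r β

/-! ## Orientation 1: rows = input coordinates `b`, columns `(s, c)` -/

/-- Row of the second flattening for the input coordinate `b`: columns `(s, c)`, code `c + (l n) s`,
`s` running over the supplied elements `xs` of `S_K`. -/
def flatRow1 (l m n : ℕ) (xs : List ℕ) (b : ℕ) : ℕ :=
  maskOf (fun t => tbit m n (xs.getD (t / (l * n)) 0) b (t % (l * n))) (xs.length * (l * n))

/-- The second flattening check. -/
def flat1Check (l m n : ℕ) (K xs bs : List ℕ) : Bool :=
  xs.all (memB (l * m) K) && bs.all (· < m * n) && indepB (bs.map (flatRow1 l m n xs))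

/-- Soundness of the second flattening check: `|bs| ≤ dim range ψ_K.flip`. -/
theorem le_finrank_of_flat1Check {l m n : ℕ} {K xs bs : List ℕ} (h : flat1Check l m n K xs bs = true) :
    bs.length ≤ finrank (ZMod 2) (LinearMap.range (psiK l m n K).flip) := by
  simp only [flat1Check, Bool.and_eq_true, List.all_eq_true, decide_eq_true_eq] at h
  obtain ⟨⟨hmem, hbs⟩, hind⟩ := h
  have hmem' : ∀ s : Fin xs.length, memB (l * m) K (xs.getD s 0) = true := fun s => by
    rw [List.getD_eq_getElem _ _ s.2]; exact hmem _ (List.getElem_mem s.2)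
  have hbs' : ∀ i : Fin bs.length, bs.getD i 0 < m * n := fun i => by
    rw [List.getD_eq_getElem _ _ i.2]; exact hbs _ (List.getElem_mem i.2)
  let E := (finProdFinEquiv : Fin xs.length × Fin (l * n) ≃ Fin (xs.length * (l * n)))
  refine le_finrank_range_of_indepB (psiK l m n K).flip
    (fun i => vB m n ⟨bs.getD i 0, hbs' i⟩)
    (fun t => elemOf l m K (xs.getD (E.symm t).1 0) (hmem' _)) (fun t => eC l n (E.symm t).2)
    (fun i t => tbit m n (xs.getD (t / (l * n)) 0) (bs.getD i 0) (t % (l * n))) ?_ ?_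
  · intro i t
    simp only [LinearMap.flip_apply, LinearMap.comp_apply, Submodule.subtype_apply, elemOf,
      mulBilin_apply, E, finProdFinEquiv_symm_apply, eC_mul_vB, Fin.coe_divNat, Fin.coe_modNat]
    rfl
  · change indepB (List.ofFn fun i : Fin bs.length => flatRow1 l m n xs (bs.getD i 0)) = true
    rw [ofFn_getD_map]
    exact hind

/-- **Flattening bound, orientation 1**: every computation of `ψ_K` has at least `|bs|` products. -/
theorem le_of_flat1Check {l m n : ℕ} {K xs bs : List ℕ} (h : flat1Check l m n K xs bs = true) (r : ℕ)
    (β : BilinComp (psiK l m n K) (Fin r)) : bs.length ≤ r :=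
  le_of_finrank_range_flip_le (le_finrank_of_flat1Check h) r β

/-! ## Orientation 2: rows = output coordinates `c`, columns `(s, b)` -/

/-- Row of the third flattening for the output coordinate `c`: columns `(s, b)`, code `b + (m n) s`. -/
def flatRow2 (m n : ℕ) (xs : List ℕ) (c : ℕ) : ℕ :=
  maskOf (fun t => tbit m n (xs.getD (t / (m * n)) 0) (t % (m * n)) c) (xs.length * (m * n))

/-- The third flattening check. -/
def flat2Check (l m n : ℕ) (K xs cs : List ℕ) : Bool :=
  xs.all (memB (l * m) K) && cs.all (· < l * n) && indepB (cs.map (flatRow2 m n xs))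

/-- Soundness of the third flattening check: `|cs| ≤ dim range (rotate ψ_K).flip`. -/
theorem le_finrank_of_flat2Check {l m n : ℕ} {K xs cs : List ℕ} (h : flat2Check l m n K xs cs = true) :
    cs.length ≤ finrank (ZMod 2) (LinearMap.range (rotateMap (psiK l m n K)).flip) := by
  simp only [flat2Check, Bool.and_eq_true, List.all_eq_true, decide_eq_true_eq] at h
  obtain ⟨⟨hmem, hcs⟩, hind⟩ := h
  have hmem' : ∀ s : Fin xs.length, memB (l * m) K (xs.getD s 0) = true := fun s => by
    rw [List.getD_eq_getElem _ _ s.2]; exact hmem _ (List.getElem_mem s.2)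
  have hcs' : ∀ i : Fin cs.length, cs.getD i 0 < l * n := fun i => by
    rw [List.getD_eq_getElem _ _ i.2]; exact hcs _ (List.getElem_mem i.2)
  let E := (finProdFinEquiv : Fin xs.length × Fin (m * n) ≃ Fin (xs.length * (m * n)))
  refine le_finrank_range_of_indepB (rotateMap (psiK l m n K)).flip
    (fun i => eC l n ⟨cs.getD i 0, hcs' i⟩)
    (fun t => vB m n (E.symm t).2)
    (fun t => Module.Dual.eval (ZMod 2) _ (elemOf l m K (xs.getD (E.symm t).1 0) (hmem' _)))
    (fun i t => tbit m n (xs.getD (t / (m * n)) 0) (t % (m * n)) (cs.getD i 0)) ?_ ?_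
  · intro i t
    simp only [Module.Dual.eval_apply, LinearMap.flip_apply, rotateMap_apply, LinearMap.comp_apply,
      Submodule.subtype_apply, elemOf, mulBilin_apply, E, finProdFinEquiv_symm_apply, eC_mul_vB,
      Fin.coe_divNat, Fin.coe_modNat]
    rfl
  · change indepB (List.ofFn fun i : Fin cs.length => flatRow2 m n xs (cs.getD i 0)) = true
    rw [ofFn_getD_map]
    exact hind

/-- **Flattening bound, orientation 2**: every computation of `ψ_K` has at least `|cs|` products. -/
theorem le_of_flat2Check {l m n : ℕ} {K xs cs : List ℕ} (h : flat2Check l m n K xs cs = true) (r : ℕ)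
    (β : BilinComp (psiK l m n K) (Fin r)) : cs.length ≤ r := by
  simpa using (le_finrank_of_flat2Check h).trans β.rotate.flip.finrank_range_le_card

end Summit.MatrixMultiplication.OmegaCensus.GF2RankLB
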